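import Literature.AlgebraicGeometry.HodgeTheory.ComplexOrientationDegreeOne
import Literature.AlgebraicTopology.SingularHomology.DegreeFromFiniteFibre
import Literature.AlgebraicGeometry.Motives.OpenImmersionGraph
import Literature.NumberTheory.Transcendental.AnalytificationProjProofs
import HarnessLib

/-!
# The degree of a morphism of smooth projective complex varieties over a finite étale fibre, for
# the complex orientations: `q_* 1 = k • 1`

Family `hodge`, layer `Literature/AlgebraicGeometry/HodgeTheory`. W. Fulton, *Intersection Theory*
(1998), Lemma 19.1.2: `f_* cl(V) = deg(V/W) cl(W)`; between SMOOTH projective varieties of the same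
dimension and read topologically (Milnor, *Topology from the Differentiable Viewpoint* §5; Hatcher
Prop. 2.30): if a complex point `b` of `W` has exactly `k` complex points in its fibre and `q(ℂ)` is
a local homeomorphism at each of them (e.g. `b` lies in the finite étale locus), then
`q(ℂ)_* [T(ℂ)] = k • [W(ℂ)]` for the COMPLEX orientations — every sheet counts `+1` because a
holomorphic local homeomorphism preserves the complex orientation (Milnor–Stasheff §13). This file
proves it on the tree's carriers:

* `isPositiveAtlas_complexPoints_of_smooth` — the atlas of holomorphic algebraic charts of `X(ℂ)` is
  positive for every `X` smooth of relative dimension `n` and locally of finite type over `ℂ` (the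
  argument of `isPositiveAtlas_complexPoints`, without projectivity);
* `map_localClass_eq_of_openPartialHomeomorph` — **a morphism which is a local homeomorphism at `P`
  and has the single fibre point `P` over `f P` carries the complex local orientation class at `P`
  to the one at `f P`** (`f : X' ⟶ X` between smooth separated `ℂ`-schemes of the same dimension,
  `e : X'(ℂ) ⇀ X(ℂ)` an open partial homeomorphism with total function `f(ℂ)` and `P ∈ e.source`):
  `f(ℂ)` is holomorphic in the algebraic charts (`differentiableOn_algebraicChart_map`) and injective
  near `P`, so its complex Jacobian is invertible (`SCV.bijective_fderiv_of_injOn`) and the real one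
  has determinant `|det_ℂ|² > 0` (`positiveAtlasOrientation_map_localClass`);
* `hasDegree_complexOrientationInt_of_finite_fibre`, `hasDegree_complexOrientationRat_of_finite_fibre`,
  `map_fundamentalClass_complexOrientationFamily_of_finite_fibre`,
  `complexGysin_complexOrientationFamily_one_of_finite_fibre` — **for `q : T ⟶ W` between smooth
  projective `d`-folds and a complex point `b` whose fibre is `{v i}ᵢ` (`v : ι ↪ T(ℂ)`) with `q(ℂ)`
  a local homeomorphism at each `v i`, `q(ℂ)_* [T(ℂ)] = (#ι) • [W(ℂ)]` for the complex
  orientations** (integral, rational, the complex family), **hence `q_* 1 = (#ι) • 1`** for the Gysin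
  morphism `complexGysin complexOrientationFamily`: the sheets are the open subschemes
  `T ∖ {v l : l ≠ i}` with their complex orientations (`hasDegree_of_finite_fibre`).

Everything is proved; no definitions, no named facts. With the existence of such a fibre with
`#ι = [K(T) : K(W)]` for generically finite `q` (finite étale locus) and the domination of rational
maps, this is the general case of `Fulton1998_degreeFormula_complexOrientation`.

## References

* [Fulton1998] W. Fulton, Intersection Theory, 2nd ed., Springer 1998, §1.4, Lemma 19.1.2.
* [MilnorTDV1965] J. Milnor, Topology from the Differentiable Viewpoint, 1965, §5.
* [MilnorStasheff1974] J. Milnor, J. Stasheff, Characteristic Classes, PUP 1974, §13 p. 151.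
* [HatcherAT2002] A. Hatcher, Algebraic Topology, CUP 2002, §2.2 Prop. 2.30, §3.3 Thm. 3.26.
* [SerreGAGA1956] J.-P. Serre, GAGA, Ann. Inst. Fourier 6 (1956), §2 n°5 Prop. 2.
-/

noncomputable section

open scoped ContDiff Topology
open CategoryTheory AlgebraicGeometry Set Filter
open Literature.AlgebraicTopology.SingularHomology Literature.Topology.FourManifolds

namespace Literature.AlgebraicGeometry.HodgeTheory

section HodgeTheory

open Literature.AlgebraicGeometry.Motives

variable {n : ℕ} {X' X : Motives.SchemeOver ℂ}

/-! ### Positivity of the algebraic atlas without projectivity -/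

/-- **The atlas of holomorphic algebraic charts of `X(ℂ)` is positive** for `X` smooth of relative
dimension `n` and locally of finite type over `ℂ` (`Motives.ComplexPoints.chartedSpace X n`): the
chart changes are realifications of holomorphic maps with invertible differentials, of Jacobian
determinant `|det_ℂ|² > 0` (the argument of `isPositiveAtlas_complexPoints`, which assumed `X` smooth
projective). [cite: MilnorStasheff1974, §13 p. 151] [cite: SerreGAGA1956, §2 n°5 Prop. 2] -/
theorem isPositiveAtlas_complexPoints_of_smooth (X : Motives.SchemeOver ℂ) (n : ℕ)
    [LocallyOfFiniteType X.hom] [SmoothOfRelativeDimension n X.hom] :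
    @IsPositiveAtlas (2 * n) (ComplexPoints X) _ (ComplexPoints.chartedSpace X n) := by
  letI := ComplexPoints.chartedSpace X n
  rintro c ⟨P, rfl⟩ c' ⟨P', rfl⟩ y ⟨hy, hy'⟩
  set a := ComplexPoints.algebraicChart X n P with ha
  set a' := ComplexPoints.algebraicChart X n P' with ha'
  set L := complexToEuclideanCLE n with hL
  rw [OpenPartialHomeomorph.transHomeomorph_source] at hy hy'
  set T : (Fin n → ℂ) → (Fin n → ℂ) := fun v ↦ a (a'.symm v) with hT
  set T' : (Fin n → ℂ) → (Fin n → ℂ) := fun u ↦ a' (a.symm u) with hT'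
  set v₀ : Fin n → ℂ := a' y with hv₀
  have hTv₀ : T v₀ = a y := by simp only [hT, hv₀, a'.left_inv hy']
  have HT : DifferentiableAt ℂ T v₀ := differentiableAt_algebraicChart_transition P P' hy hy'
  have HT' : DifferentiableAt ℂ T' (a y) := differentiableAt_algebraicChart_transition P' P hy' hy
  set A := fderiv ℂ T v₀ with hA
  set A' := fderiv ℂ T' (a y) with hA'
  have hev : (fun v ↦ T' (T v)) =ᶠ[𝓝 v₀] id := by
    have hS : IsOpen (a'.target ∩ a'.symm ⁻¹' a.source) := a'.isOpen_inter_preimage_symm a.open_source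
    have hv₀S : v₀ ∈ a'.target ∩ a'.symm ⁻¹' a.source :=
      ⟨a'.map_source hy', by rw [mem_preimage, hv₀, a'.left_inv hy']; exact hy⟩
    filter_upwards [hS.mem_nhds hv₀S] with v hv
    simp only [hT, hT', id, a.left_inv hv.2, a'.right_inv hv.1]
  have hcomp : HasFDerivAt (fun v ↦ T' (T v)) (A'.comp A) v₀ := by
    have h2 : HasFDerivAt T' A' (T v₀) := by rw [hTv₀]; exact HT'.hasFDerivAt
    exact h2.comp v₀ HT.hasFDerivAt
  have hid : HasFDerivAt (fun v ↦ T' (T v)) (ContinuousLinearMap.id ℂ _) v₀ :=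
    (hasFDerivAt_id v₀).congr_of_eventuallyEq hev
  have hAA : A'.comp A = ContinuousLinearMap.id ℂ _ := hcomp.unique hid
  have hdetA : LinearMap.det (A : (Fin n → ℂ) →ₗ[ℂ] (Fin n → ℂ)) ≠ 0 := by
    intro h0
    have h1 : LinearMap.det ((A'.comp A : (Fin n → ℂ) →L[ℂ] (Fin n → ℂ)) :
        (Fin n → ℂ) →ₗ[ℂ] (Fin n → ℂ)) =
        LinearMap.det (A' : (Fin n → ℂ) →ₗ[ℂ] (Fin n → ℂ)) *
          LinearMap.det (A : (Fin n → ℂ) →ₗ[ℂ] (Fin n → ℂ)) := by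
      rw [show ((A'.comp A : (Fin n → ℂ) →L[ℂ] (Fin n → ℂ)) : (Fin n → ℂ) →ₗ[ℂ] (Fin n → ℂ)) =
        (A' : (Fin n → ℂ) →ₗ[ℂ] (Fin n → ℂ)).comp (A : (Fin n → ℂ) →ₗ[ℂ] (Fin n → ℂ)) from rfl,
        LinearMap.det_comp]
    rw [hAA, h0, mul_zero] at h1
    exact one_ne_zero (LinearMap.det_id.symm.trans h1)
  have hreal : (fun x ↦ (a.transHomeomorph (complexToEuclidean n))
      ((a'.transHomeomorph (complexToEuclidean n)).symm x)) = fun x ↦ L (T (L.symm x)) := by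
    funext x
    rfl
  have hderiv : HasFDerivAt (fun x ↦ (a.transHomeomorph (complexToEuclidean n))
      ((a'.transHomeomorph (complexToEuclidean n)).symm x))
      ((L : (Fin n → ℂ) →L[ℝ] _).comp ((A.restrictScalars ℝ).comp (L.symm : _ →L[ℝ] (Fin n → ℂ))))
      ((a'.transHomeomorph (complexToEuclidean n)) y) := by
    rw [hreal]
    have hy₀ : (a'.transHomeomorph (complexToEuclidean n)) y = L v₀ := rfl
    rw [hy₀]
    have h1 : HasFDerivAt (fun x ↦ L.symm x) (L.symm : _ →L[ℝ] (Fin n → ℂ)) (L v₀) := L.symm.hasFDerivAt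
    have h2 : HasFDerivAt T (A.restrictScalars ℝ) (L.symm (L v₀)) := by
      rw [L.symm_apply_apply]
      exact HT.hasFDerivAt.restrictScalars ℝ
    have h3 : HasFDerivAt (fun u ↦ L u) (L : (Fin n → ℂ) →L[ℝ] _) (T (L.symm (L v₀))) := L.hasFDerivAt
    exact h3.comp (L v₀) (h2.comp (L v₀) h1)
  refine ⟨_, hderiv, ?_⟩
  rw [det_conj_continuousLinearEquiv]
  have hrs : ((A.restrictScalars ℝ : (Fin n → ℂ) →L[ℝ] (Fin n → ℂ)) : (Fin n → ℂ) →ₗ[ℝ] (Fin n → ℂ)) =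
      (A : (Fin n → ℂ) →ₗ[ℂ] (Fin n → ℂ)).restrictScalars ℝ := rfl
  rw [hrs, det_restrictScalars_eq_normSq]
  exact Complex.normSq_pos.2 hdetA

/-! ### A local homeomorphism carries the complex local orientation class across -/

/-- **A morphism of smooth `ℂ`-schemes of the same dimension which is a local homeomorphism at `P`,
with `P` the only point of its fibre, carries the complex local orientation class at `P` to the one
at `f P`.** Here `X'`, `X` are smooth of relative dimension `n`, locally of finite type and separated
over `ℂ`, with the positive-atlas orientations of their holomorphic algebraic atlases for the same
generator `g`; `e : X'(ℂ) ⇀ X(ℂ)` is an open partial homeomorphism whose total function is `f(ℂ)`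
and `P ∈ e.source`. Proof: `f(ℂ)` read in the algebraic charts at `P`, `f P` is holomorphic
(`differentiableOn_algebraicChart_map`) and injective near the point (it is `e`), so its complex
Jacobian is invertible (Osgood) and the real one has positive determinant; then
`positiveAtlasOrientation_map_localClass`. [cite: MilnorStasheff1974, §13 p. 151]
[cite: HatcherAT2002, §3.3 p. 233] -/
theorem map_localClass_eq_of_openPartialHomeomorph [LocallyOfFiniteType X'.hom]
    [SmoothOfRelativeDimension n X'.hom] [IsSeparated X'.hom] [LocallyOfFiniteType X.hom]
    [SmoothOfRelativeDimension n X.hom] [IsSeparated X.hom]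
    (g : HomologicalOrientation ℤ (EuclideanSpace ℝ (Fin (2 * n))) (2 * n)) (f : X' ⟶ X)
    (e : OpenPartialHomeomorph (ComplexPoints X') (ComplexPoints X))
    (he : (e : ComplexPoints X' → ComplexPoints X) = AlgPoints.map f) {P : ComplexPoints X'}
    (hP : P ∈ e.source) {b : ComplexPoints X} (hb : AlgPoints.map f P = b)
    (hfib : MapsTo (AlgPoints.map f) ({P}ᶜ : Set (ComplexPoints X')) ({b}ᶜ : Set (ComplexPoints X))) :
    letI := ComplexPoints.chartedSpace X' n
    letI := ComplexPoints.chartedSpace X n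
    haveI := ComplexPoints.t2Space_of_isSeparated X'
    haveI := ComplexPoints.t2Space_of_isSeparated X
    relativeSingularHomology.map ℤ ℤ (AlgPoints.mapContinuous (L := ℂ) f) hfib (2 * n)
        ((positiveAtlasOrientation (isPositiveAtlas_complexPoints_of_smooth X' n) g).localClass P) =
      (positiveAtlasOrientation (isPositiveAtlas_complexPoints_of_smooth X n) g).localClass b := by
  subst hb
  letI := ComplexPoints.chartedSpace X' n
  letI := ComplexPoints.chartedSpace X n
  haveI := ComplexPoints.t2Space_of_isSeparated X'
  haveI := ComplexPoints.t2Space_of_isSeparated X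
  set F : C(ComplexPoints X', ComplexPoints X) := AlgPoints.mapContinuous (L := ℂ) f with hF
  have hFe : ∀ Q, e Q = F Q := fun Q ↦ congr_fun he Q
  -- the written-out map in the algebraic charts
  set a' := ComplexPoints.algebraicChart X' n P with ha'
  set a := ComplexPoints.algebraicChart X n (F P) with ha
  set L := complexToEuclideanCLE n with hL
  set T : (Fin n → ℂ) → (Fin n → ℂ) := fun u ↦ a (F (a'.symm u)) with hT
  set O : Set (Fin n → ℂ) := a'.target ∩ a'.symm ⁻¹' (F ⁻¹' a.source ∩ e.source) with hO
  have hOo : IsOpen O :=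
    a'.isOpen_inter_preimage_symm ((a.open_source.preimage F.continuous).inter e.open_source)
  have hsrc' : P ∈ a'.source := ComplexPoints.mem_algebraicChart_source X' n P
  have hsrc : F P ∈ a.source := ComplexPoints.mem_algebraicChart_source X n (F P)
  have hp : a' P ∈ O := by
    refine ⟨a'.map_source hsrc', ?_⟩
    rw [mem_preimage, a'.left_inv hsrc']
    exact ⟨hsrc, hP⟩
  have hTdiff : DifferentiableOn ℂ T O :=
    (differentiableOn_algebraicChart_map f P).mono fun u hu ↦ ⟨hu.1, hu.2.1⟩
  have hTinj : Set.InjOn T O := by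
    intro u₁ hu₁ u₂ hu₂ h
    have h1 : F (a'.symm u₁) = F (a'.symm u₂) := a.injOn hu₁.2.1 hu₂.2.1 h
    have h2 : a'.symm u₁ = a'.symm u₂ := by
      rw [← hFe, ← hFe] at h1
      exact e.injOn hu₁.2.2 hu₂.2.2 h1
    exact a'.symm.injOn hu₁.1 hu₂.1 h2
  have hbij := Literature.Analysis.Complex.SCV.bijective_fderiv_of_injOn rfl hTdiff hOo hTinj hp
  set Aℂ : (Fin n → ℂ) →L[ℂ] (Fin n → ℂ) := fderiv ℂ T (a' P) with hAℂ
  have HT : HasFDerivAt T Aℂ (a' P) := (hTdiff.differentiableAt (hOo.mem_nhds hp)).hasFDerivAt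
  have hdetℂ : LinearMap.det (Aℂ : (Fin n → ℂ) →ₗ[ℂ] (Fin n → ℂ)) ≠ 0 := by
    have hbij' : Function.Bijective (Aℂ : (Fin n → ℂ) →ₗ[ℂ] (Fin n → ℂ)) := hbij
    have hu := (LinearEquiv.ofBijective (Aℂ : (Fin n → ℂ) →ₗ[ℂ] (Fin n → ℂ)) hbij').isUnit_det'
    have hcoe : ((LinearEquiv.ofBijective (Aℂ : (Fin n → ℂ) →ₗ[ℂ] (Fin n → ℂ)) hbij' :
        (Fin n → ℂ) ≃ₗ[ℂ] (Fin n → ℂ)) : (Fin n → ℂ) →ₗ[ℂ] (Fin n → ℂ)) =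
        (Aℂ : (Fin n → ℂ) →ₗ[ℂ] (Fin n → ℂ)) := LinearMap.ext fun _ ↦ rfl
    rw [hcoe] at hu
    exact hu.ne_zero
  set A : EuclideanSpace ℝ (Fin (2 * n)) →L[ℝ] EuclideanSpace ℝ (Fin (2 * n)) :=
    (L : (Fin n → ℂ) →L[ℝ] _).comp ((Aℂ.restrictScalars ℝ).comp (L.symm : _ →L[ℝ] (Fin n → ℂ)))
    with hA
  have hA' : HasFDerivAt (fun v ↦ chartAt (EuclideanSpace ℝ (Fin (2 * n))) (e P)
      (e ((chartAt (EuclideanSpace ℝ (Fin (2 * n))) P).symm v))) A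
      (chartAt (EuclideanSpace ℝ (Fin (2 * n))) P P) := by
    have hreal : (fun v ↦ chartAt (EuclideanSpace ℝ (Fin (2 * n))) (e P)
        (e ((chartAt (EuclideanSpace ℝ (Fin (2 * n))) P).symm v))) = fun v ↦ L (T (L.symm v)) := by
      funext v
      change L (ComplexPoints.algebraicChart X n (e P) (e (a'.symm (L.symm v)))) = L (T (L.symm v))
      rw [hT, hFe, hFe]
    have hpt : chartAt (EuclideanSpace ℝ (Fin (2 * n))) P P = L (a' P) := rfl
    rw [hreal, hpt]
    have h1 : HasFDerivAt (fun x ↦ L.symm x) (L.symm : _ →L[ℝ] (Fin n → ℂ)) (L (a' P)) :=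
      L.symm.hasFDerivAt
    have h2 : HasFDerivAt T (Aℂ.restrictScalars ℝ) (L.symm (L (a' P))) := by
      rw [L.symm_apply_apply]
      exact HT.restrictScalars ℝ
    have h3 : HasFDerivAt (fun u ↦ L u) (L : (Fin n → ℂ) →L[ℝ] _) (T (L.symm (L (a' P)))) :=
      L.hasFDerivAt
    exact h3.comp (L (a' P)) (h2.comp (L (a' P)) h1)
  have hdet : 0 < LinearMap.det (A : EuclideanSpace ℝ (Fin (2 * n)) →ₗ[ℝ] EuclideanSpace ℝ (Fin (2 * n))) := by
    rw [hA, det_conj_continuousLinearEquiv]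
    have hrs : ((Aℂ.restrictScalars ℝ : (Fin n → ℂ) →L[ℝ] (Fin n → ℂ)) : (Fin n → ℂ) →ₗ[ℝ] (Fin n → ℂ)) =
        (Aℂ : (Fin n → ℂ) →ₗ[ℂ] (Fin n → ℂ)).restrictScalars ℝ := rfl
    rw [hrs, det_restrictScalars_eq_normSq]
    exact Complex.normSq_pos.2 hdetℂ
  have hec : Continuous e := by rw [he]; exact F.continuous
  have hfib' : MapsTo e ({P}ᶜ : Set (ComplexPoints X')) ({e P}ᶜ : Set (ComplexPoints X)) := by
    rw [he]; exact hfib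
  have hloc := positiveAtlasOrientation_map_localClass (isPositiveAtlas_complexPoints_of_smooth X' n)
    (isPositiveAtlas_complexPoints_of_smooth X n) g e hec hP hfib' hA' hdet
  -- `⟨e, _⟩ = F` as continuous maps
  have hFe' : (⟨e, hec⟩ : C(ComplexPoints X', ComplexPoints X)) = F :=
    ContinuousMap.ext fun Q ↦ hFe Q
  rw [relativeSingularHomology.map.congr_simp ℤ ℤ _ _ hFe' hfib' (2 * n)] at hloc
  suffices H : ∀ b : ComplexPoints X, e P = b →
      ∀ h : MapsTo F ({P}ᶜ : Set (ComplexPoints X')) ({b}ᶜ : Set (ComplexPoints X)),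
        relativeSingularHomology.map ℤ ℤ F h (2 * n)
          ((positiveAtlasOrientation (isPositiveAtlas_complexPoints_of_smooth X' n) g).localClass P) =
        (positiveAtlasOrientation (isPositiveAtlas_complexPoints_of_smooth X n) g).localClass b from
    H _ (hFe P) hfib
  rintro b rfl h
  exact hloc

/-! ### The degree over a finite good fibre -/

section FiniteFibre

variable {d : ℕ} {T W : Motives.SchemeOver ℂ}

/-- **`q(ℂ)_* [T(ℂ)] = (#ι) • [W(ℂ)]` over a finite fibre of local homeomorphism points, for the
complex orientations with coefficients extended to `R`.** Let `q : T ⟶ W` be a morphism of smooth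
projective `d`-folds and `b` a complex point of `W` whose fibre `q(ℂ)⁻¹(b)` is `{v i}ᵢ` (`v`
injective) with `q(ℂ)` a local homeomorphism at every `v i` (an open partial homeomorphism through
`v i` with total function `q(ℂ)`). Then `q(ℂ)_* [T(ℂ)] = (#ι) • [W(ℂ)]` for the orientations
`complexOrientationInt ⊗ R`: the sheets of `hasDegree_of_finite_fibre` are the open subschemes
`T ∖ {v l : l ≠ i}` with their complex orientations, which the open immersions into `T` and the
restrictions of `q` carry to the complex local classes of `T` and `W`
(`map_localClass_eq_of_openPartialHomeomorph`). [cite: Fulton1998, Lemma 19.1.2]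
[cite: MilnorTDV1965, §5] [cite: HatcherAT2002, §2.2 Prop. 2.30] -/
theorem hasDegree_toCoeff_complexOrientationInt_of_finite_fibre (R : Type) [CommRing R]
    (hT : IsSmoothProjective d T) (hW : IsSmoothProjective d W) (q : T ⟶ W)
    {ι : Type} [Fintype ι] {v : ι → ComplexPoints T} (hv : Function.Injective v)
    {b : ComplexPoints W} (hfibre : (AlgPoints.map q) ⁻¹' {b} = Set.range v)
    (hloc : ∀ i, ∃ e : OpenPartialHomeomorph (ComplexPoints T) (ComplexPoints W),
      v i ∈ e.source ∧ (e : ComplexPoints T → ComplexPoints W) = AlgPoints.map q) :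
    letI := hT.chartedSpace
    letI := hW.chartedSpace
    haveI := ComplexPoints.t2Space_of_isSmoothProjective hT
    haveI := ComplexPoints.t2Space_of_isSmoothProjective hW
    HasDegree ((complexOrientationInt hT).toCoeff R) ((complexOrientationInt hW).toCoeff R)
      (AlgPoints.mapContinuous (L := ℂ) q) (Fintype.card ι) := by
  letI := hT.chartedSpace
  letI := hW.chartedSpace
  haveI := ComplexPoints.compactSpace_of_isSmoothProjective hT
  haveI := ComplexPoints.compactSpace_of_isSmoothProjective hW
  haveI := ComplexPoints.t2Space_of_isSmoothProjective hT
  haveI := ComplexPoints.t2Space_of_isSmoothProjective hW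
  haveI := connectedSpace_complexPoints hW
  haveI : IsProper T.hom := IsSmoothProjective.isProper_holds hT
  haveI : IsProper W.hom := IsSmoothProjective.isProper_holds hW
  haveI := hT.smoothOfRelativeDimension
  haveI := hW.smoothOfRelativeDimension
  classical
  set F : C(ComplexPoints T, ComplexPoints W) := AlgPoints.mapContinuous (L := ℂ) q with hF
  -- the points `v i` have pairwise distinct (closed) underlying points
  have hpt : ∀ i l, (v i).pt = (v l).pt → i = l := fun i l h ↦ hv (ComplexPoints.ext_of_pt_eq h)
  -- the open subschemes `T ∖ {v l : l ≠ i}` and their open immersions `j i`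
  have hOopen : ∀ i, IsOpen {t : T.left | ∀ l, l ≠ i → t ≠ (v l).pt} := by
    intro i
    have hrepr : {t : T.left | ∀ l, l ≠ i → t ≠ (v l).pt} = ⋂ l, {t | l ≠ i → t ≠ (v l).pt} := by
      ext t
      simp only [Set.mem_setOf_eq, Set.mem_iInter]
    rw [hrepr]
    refine isOpen_iInter_of_finite fun l ↦ ?_
    by_cases hli : l = i
    · have h1 : {t : T.left | l ≠ i → t ≠ (v l).pt} = Set.univ := by
        ext t
        simp [hli]
      rw [h1]
      exact isOpen_univ
    · have h1 : {t : T.left | l ≠ i → t ≠ (v l).pt} = ({(v l).pt} : Set T.left)ᶜ := by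
        ext t
        simp [hli]
      rw [h1]
      exact (OpenGraph.isClosed_singleton_pt (v l)).isOpen_compl
  set O : ι → T.left.Opens := fun i ↦ ⟨{t | ∀ l, l ≠ i → t ≠ (v l).pt}, hOopen i⟩ with hO
  set Ti : ι → SchemeOver ℂ := fun i ↦ openSubschemeOver T (O i) with hTi
  set j : ∀ i, Ti i ⟶ T := fun i ↦ openSubschemeOverι T (O i) with hj
  haveI hjimm : ∀ i, IsOpenImmersion (j i).left := fun i ↦ inferInstanceAs (IsOpenImmersion (O i).ι)
  haveI : ∀ i, LocallyOfFiniteType (Ti i).hom := fun i ↦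
    inferInstanceAs (LocallyOfFiniteType ((O i).ι ≫ T.hom))
  haveI : ∀ i, SmoothOfRelativeDimension d (Ti i).hom := fun i ↦ by
    have h : SmoothOfRelativeDimension (0 + d) ((O i).ι ≫ T.hom) := inferInstance
    rw [Nat.zero_add] at h
    exact h
  haveI : ∀ i, IsSeparated (Ti i).hom := fun i ↦ inferInstanceAs (IsSeparated ((O i).ι ≫ T.hom))
  haveI : ∀ i, T2Space (ComplexPoints (Ti i)) := fun i ↦ ComplexPoints.t2Space_of_isSeparated (Ti i)
  letI : ∀ i, ChartedSpace (EuclideanSpace ℝ (Fin (2 * d))) (ComplexPoints (Ti i)) := fun i ↦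
    ComplexPoints.chartedSpace (Ti i) d
  have hrange : ∀ i, Set.range (AlgPoints.map (L := ℂ) (j i)) = {Q : ComplexPoints T | Q.pt ∈ O i} := by
    intro i
    rw [AlgPoints.range_map_of_isOpenImmersion_holds (j i)]
    ext Q
    change Q.pt ∈ (O i).ι.opensRange ↔ Q.pt ∈ O i
    rw [Scheme.Opens.opensRange_ι]
  have hvO : ∀ i, (v i).pt ∈ O i := fun i l hli h ↦ hli (hpt i l h).symm
  have hy : ∀ i, ∃ y : ComplexPoints (Ti i), AlgPoints.map (j i) y = v i := fun i ↦ by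
    have h1 : v i ∈ Set.range (AlgPoints.map (L := ℂ) (j i)) := by
      rw [hrange]
      exact hvO i
    exact h1
  choose y hyv using hy
  set g : ∀ i, C(ComplexPoints (Ti i), ComplexPoints T) := fun i ↦
    AlgPoints.mapContinuous (L := ℂ) (j i) with hg
  have hge : ∀ i, Topology.IsOpenEmbedding (g i) := fun i ↦ AlgPoints.isOpenEmbedding_map_holds (j i)
  have hgy : ∀ i, g i (y i) = v i := hyv
  have hsep : ∀ i l, l ≠ i → v l ∉ Set.range (g i) := by
    intro i l hli hmem
    have h1 : (v l).pt ∈ O i := by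
      have h2 : v l ∈ Set.range (AlgPoints.map (L := ℂ) (j i)) := hmem
      rw [hrange] at h2
      exact h2
    exact h1 l hli rfl
  haveI : ∀ i, Nonempty (ComplexPoints (Ti i)) := fun i ↦ ⟨y i⟩
  -- `v i` lies over `b`
  have hvb : ∀ i, AlgPoints.map q (v i) = b := fun i ↦ by
    have h1 : v i ∈ (AlgPoints.map q) ⁻¹' {b} := by
      rw [hfibre]
      exact ⟨i, rfl⟩
    exact h1
  -- the complex orientations of the sheets and the two local identities, over `ℤ`
  set μi : ∀ i, HomologicalOrientation ℤ (ComplexPoints (Ti i)) (2 * d) := fun i ↦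
    positiveAtlasOrientation (isPositiveAtlas_complexPoints_of_smooth (Ti i) d)
      (euclideanGenerator (2 * d)) with hμi
  have hfibj : ∀ i, MapsTo (g i) ({y i}ᶜ : Set (ComplexPoints (Ti i)))
      ({v i}ᶜ : Set (ComplexPoints T)) :=
    fun i ↦ mapsTo_compl_singleton_of_injective (hge i).injective (hgy i)
  have hgc : ∀ i, relativeSingularHomology.map ℤ ℤ (g i) (hfibj i) (2 * d) ((μi i).localClass (y i)) =
      (complexOrientationInt hT).localClass (v i) := by
    intro i
    exact map_localClass_eq_of_openPartialHomeomorph (euclideanGenerator (2 * d)) (j i)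
      ((hge i).toOpenPartialHomeomorph (g i)) ((hge i).toOpenPartialHomeomorph_apply (g i))
      (by rw [(hge i).toOpenPartialHomeomorph_source]; exact Set.mem_univ _) (hgy i) (hfibj i)
  have hfgc : ∀ i, ∀ h : MapsTo (F.comp (g i)) ({y i}ᶜ : Set (ComplexPoints (Ti i)))
      ({b}ᶜ : Set (ComplexPoints W)),
      relativeSingularHomology.map ℤ ℤ (F.comp (g i)) h (2 * d) ((μi i).localClass (y i)) =
        (complexOrientationInt hW).localClass b := by
    intro i h
    obtain ⟨e₀, he₀src, he₀⟩ := hloc i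
    set ej := (hge i).toOpenPartialHomeomorph (g i) with hej
    have hejg : ∀ P, ej P = g i P := fun P ↦ congr_fun ((hge i).toOpenPartialHomeomorph_apply (g i)) P
    have hb : AlgPoints.map (j i ≫ q) (y i) = b := by
      rw [AlgPoints.map_comp_apply]
      change AlgPoints.map q (g i (y i)) = b
      rw [hgy]
      exact hvb i
    have he : ((ej.trans e₀ : OpenPartialHomeomorph (ComplexPoints (Ti i)) (ComplexPoints W)) :
        ComplexPoints (Ti i) → ComplexPoints W) = AlgPoints.map (j i ≫ q) := by
      funext P
      rw [OpenPartialHomeomorph.coe_trans, Function.comp_apply, he₀, AlgPoints.map_comp_apply, hejg]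
      rfl
    have hP : y i ∈ (ej.trans e₀).source := by
      rw [OpenPartialHomeomorph.trans_source, hej, (hge i).toOpenPartialHomeomorph_source]
      refine ⟨Set.mem_univ _, ?_⟩
      rw [Set.mem_preimage, ← hej, hejg, hgy]
      exact he₀src
    have hfib' : MapsTo (AlgPoints.map (j i ≫ q)) ({y i}ᶜ : Set (ComplexPoints (Ti i)))
        ({b}ᶜ : Set (ComplexPoints W)) := by
      intro z hz hzb
      apply hz
      rw [Set.mem_singleton_iff] at hzb ⊢
      rw [AlgPoints.map_comp_apply] at hzb
      have hmem : AlgPoints.map (j i) z ∈ (AlgPoints.map q) ⁻¹' {b} := hzb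
      rw [hfibre] at hmem
      obtain ⟨l, hl⟩ := hmem
      by_cases hli : l = i
      · subst hli
        apply (hge l).injective
        change AlgPoints.map (j l) z = g l (y l)
        rw [hgy, hl]
      · exact absurd ⟨z, hl.symm⟩ (hsep i l hli)
    have key := map_localClass_eq_of_openPartialHomeomorph (euclideanGenerator (2 * d)) (j i ≫ q)
      (ej.trans e₀) he hP hb hfib'
    have hcomp : AlgPoints.mapContinuous (L := ℂ) (j i ≫ q) = F.comp (g i) :=
      ContinuousMap.ext fun P ↦ AlgPoints.map_comp_apply _ _ _
    rw [relativeSingularHomology.map.congr_simp ℤ ℤ _ _ hcomp hfib' (2 * d)] at key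
    exact key
  -- transfer to `R` and conclude with `hasDegree_of_finite_fibre`
  have hgcR : ∀ i, relativeSingularHomology.map R R (g i) (hfibj i) (2 * d)
      (((μi i).toCoeff R).localClass (y i)) = ((complexOrientationInt hT).toCoeff R).localClass (v i) :=
    fun i ↦ HomologicalOrientation.map_toCoeff_localClass R (g i) (hfibj i) (μi i)
      (complexOrientationInt hT) (hgc i)
  have hfgcR : ∀ i, ∀ h : MapsTo (F.comp (g i)) ({y i}ᶜ : Set (ComplexPoints (Ti i)))
      ({b}ᶜ : Set (ComplexPoints W)),
      relativeSingularHomology.map R R (F.comp (g i)) h (2 * d) (((μi i).toCoeff R).localClass (y i)) =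
        ((complexOrientationInt hW).toCoeff R).localClass b :=
    fun i h ↦ HomologicalOrientation.map_toCoeff_localClass R (F.comp (g i)) h (μi i)
      (complexOrientationInt hW) (hfgc i h)
  exact hasDegree_of_finite_fibre F ((complexOrientationInt hT).toCoeff R)
    ((complexOrientationInt hW).toCoeff R) hv hfibre y g hge hgy hsep
    (fun i ↦ ((μi i).toCoeff R).localClass (y i)) hgcR hfgcR

/-- **`q(ℂ)_* [T(ℂ)]_ℚ = (#ι) • [W(ℂ)]_ℚ`** for the rational complex orientations over a finite fibre
of local homeomorphism points. [cite: Fulton1998, Lemma 19.1.2] [cite: HatcherAT2002, §2.2 Prop. 2.30] -/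
theorem hasDegree_complexOrientationRat_of_finite_fibre
    (hT : IsSmoothProjective d T) (hW : IsSmoothProjective d W) (q : T ⟶ W)
    {ι : Type} [Fintype ι] {v : ι → ComplexPoints T} (hv : Function.Injective v)
    {b : ComplexPoints W} (hfibre : (AlgPoints.map q) ⁻¹' {b} = Set.range v)
    (hloc : ∀ i, ∃ e : OpenPartialHomeomorph (ComplexPoints T) (ComplexPoints W),
      v i ∈ e.source ∧ (e : ComplexPoints T → ComplexPoints W) = AlgPoints.map q) :
    HasDegree (complexOrientationRat hT) (complexOrientationRat hW)
      (AlgPoints.mapContinuous (L := ℂ) q) (Fintype.card ι) :=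
  hasDegree_toCoeff_complexOrientationInt_of_finite_fibre ℚ hT hW q hv hfibre hloc

/-- **`q(ℂ)_* [T(ℂ)] = (#ι) • [W(ℂ)]` for the complex orientation FAMILY** (`ℂ`-coefficients) over a
finite fibre of local homeomorphism points (`fundamentalClass_complexOrientationFamily` and change of
coefficients). [cite: Fulton1998, Lemma 19.1.2] [cite: VoisinHodgeI2002, §11.1.2] -/
theorem map_fundamentalClass_complexOrientationFamily_of_finite_fibre
    (hT : IsSmoothProjective d T) (hW : IsSmoothProjective d W) (q : T ⟶ W)
    {ι : Type} [Fintype ι] {v : ι → ComplexPoints T} (hv : Function.Injective v)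
    {b : ComplexPoints W} (hfibre : (AlgPoints.map q) ⁻¹' {b} = Set.range v)
    (hloc : ∀ i, ∃ e : OpenPartialHomeomorph (ComplexPoints T) (ComplexPoints W),
      v i ∈ e.source ∧ (e : ComplexPoints T → ComplexPoints W) = AlgPoints.map q) :
    singularHomology.map ℂ ℂ (AlgPoints.mapContinuous (L := ℂ) q) (2 * d)
        (complexOrientationFamily hT).fundamentalClass =
      (Fintype.card ι : ℂ) • (complexOrientationFamily hW).fundamentalClass := by
  have h := hasDegree_complexOrientationRat_of_finite_fibre hT hW q hv hfibre hloc
  rw [HasDegree] at h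
  rw [fundamentalClass_complexOrientationFamily, fundamentalClass_complexOrientationFamily,
    ← singularHomology.coeffChange_map, h, map_zsmul, natCast_zsmul, Nat.cast_smul_eq_nsmul]

/-- **`q_* 1 = (#ι) • 1` for the complex orientations** — Fulton's degree formula
`f_* cl(V) = deg(V/W) cl(W)` (Lemma 19.1.2) between smooth projective `d`-folds, the degree read off
a finite fibre of local homeomorphism points: for the Gysin morphism
`complexGysin complexOrientationFamily` of `q : T ⟶ W`, `q_* 1 ⌢ [W] = q(ℂ)_* [T] = (#ι) • [W]` and
Poincaré duality. [cite: Fulton1998, Lemma 19.1.2] [cite: FultonYoungTableaux1997, Appendix B §B.1 (5)] -/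
theorem complexGysin_complexOrientationFamily_one_of_finite_fibre
    (hT : IsSmoothProjective d T) (hW : IsSmoothProjective d W) (q : T ⟶ W)
    {ι : Type} [Fintype ι] {v : ι → ComplexPoints T} (hv : Function.Injective v)
    {b : ComplexPoints W} (hfibre : (AlgPoints.map q) ⁻¹' {b} = Set.range v)
    (hloc : ∀ i, ∃ e : OpenPartialHomeomorph (ComplexPoints T) (ComplexPoints W),
      v i ∈ e.source ∧ (e : ComplexPoints T → ComplexPoints W) = AlgPoints.map q) :
    complexGysin complexOrientationFamily hT hW q (rfl : 0 + 2 * d = 0 + 2 * d)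
        (singularCohomology.one ℂ (ComplexPoints T)) =
      (Fintype.card ι : ℂ) • singularCohomology.one ℂ (ComplexPoints W) := by
  have hμ : complexOrientationFamily.HasPoincareDuality := hasPoincareDuality_complexOrientationFamily
  apply (hμ hW (show 0 + 2 * d = 2 * d by omega)).1
  rw [poincareDualityMap_apply, poincareDualityMap_apply,
    capProduct_complexGysin hμ hT hW q _ (show 0 + 2 * d = 2 * d by omega)
      (show 0 + 2 * d = 2 * d by omega),
    one_capProduct, LinearMap.map_smul, LinearMap.smul_apply, one_capProduct,
    map_fundamentalClass_complexOrientationFamily_of_finite_fibre hT hW q hv hfibre hloc]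

end FiniteFibre

end HodgeTheory

end Literature.AlgebraicGeometry.HodgeTheory

end
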